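import Mathlib
import Summits.PneNP.PneNP.Theorems.SfmBlSignedModel
import Summits.PneNP.PneNP.Theorems.SfmBlSignHoeffding
import Summits.PneNP.PneNP.Theorems.SfmBlConnectedCount

/-!
# Bad signings are few — PROOF-SFM-BL Prop. 7, probabilistic half (Lemma 4 + Lemma 5 + (4.1))

FRONTIER F-N1c; nothing here bears on P vs NP.

In the abstract output-shared-sign model `sgnMat B T = Σ_e χ(T e)·B e` (`B e ≥ 0` the multiplicities of the
`≤ 3` legs of output `e`, one-sided unsigned degrees `≤ L`), call a signing `T` BAD if some vertex set `S` of
the piece graph `G ⊇ supp B` with `G[S]` connected and `|S| > t₀` has signed discrepancy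
`|1_{S∩α}ᵀ (sgnMat B T) 1_{S∩β}| > γ'·√(|S∩α|·|S∩β|)`.  We prove
`#bad ≤ 2^m · 2·(|α|+|β|) · Σ_{k=t₀+1}^{|α|+|β|} Ldeg^{2(k-1)} · exp(−γ'²·k/(12·L))`
(`Ldeg` = max degree of `G`): per `S`, Hoeffding (`card_abs_signSum_ge_le`) with `c_e = 1ᵀB_e1 ∈ [0,3]`,
`Σ c_e² ≤ 3·L·min(a,b)`, so the exponent is `≥ γ'²(a+b)/(12L)`; then a union bound over connected sets
counted by `card_connectedSets_le`.  Together with `trace_pow_le_of_good` this is Prop. 7.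
-/

namespace Summit.PneNP.PneNP.Theorems.SfmBl

open Matrix Finset BigOperators

variable {α β : Type} [Fintype α] [Fintype β] {m : ℕ}

/-- The two sides of a vertex set `S ⊆ α ⊕ β` have `|S∩α| + |S∩β| = |S|` (indicator-sum form). -/
theorem sum_indicator_inl_add_inr [DecidableEq α] [DecidableEq β] (S : Finset (α ⊕ β)) :
    (∑ i : α, (if Sum.inl i ∈ S then (1 : ℝ) else 0)) + (∑ k : β, (if Sum.inr k ∈ S then (1 : ℝ) else 0))
      = S.card := by
  rw [← Fintype.sum_sum_type (f := fun x : α ⊕ β => if x ∈ S then (1 : ℝ) else 0)]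
  rw [Finset.sum_ite_mem, Finset.univ_inter, Finset.sum_const, nsmul_eq_mul, mul_one]

/-- For 0/1 vectors `u, v` and `B ≥ 0` with `≤ L` unsigned row degrees: `uᵀ(Σ_e B_e)v ≤ L·Σu`. -/
theorem disc_unsigned_le_row (B : Fin m → Matrix α β ℝ) (hB : ∀ e i k, 0 ≤ B e i k) {L : ℝ}
    (hrow : ∀ i, ∑ e, ∑ k, B e i k ≤ L) (u : α → ℝ) (v : β → ℝ)
    (hu : ∀ i, u i = 0 ∨ u i = 1) (hv : ∀ k, v k = 0 ∨ v k = 1) :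
    u ⬝ᵥ ((∑ e, B e) *ᵥ v) ≤ L * ∑ i, u i := by
  have hu0 : ∀ i, 0 ≤ u i := fun i => by rcases hu i with h | h <;> simp [h]
  have hv1 : ∀ k, v k ≤ 1 := fun k => by rcases hv k with h | h <;> simp [h]
  have hrow' : ∀ i, ∑ k, (∑ e, B e) i k * v k ≤ L := by
    intro i
    calc ∑ k, (∑ e, B e) i k * v k ≤ ∑ k, (∑ e, B e) i k := by
          refine Finset.sum_le_sum fun k _ => ?_
          have h0 : 0 ≤ (∑ e, B e) i k := by
            rw [Matrix.sum_apply]; exact Finset.sum_nonneg fun e _ => hB e i k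
          nlinarith [hv1 k]
      _ = ∑ e, ∑ k, B e i k := by simp only [Matrix.sum_apply]; rw [Finset.sum_comm]
      _ ≤ L := hrow i
  calc u ⬝ᵥ ((∑ e, B e) *ᵥ v) = ∑ i, u i * ∑ k, (∑ e, B e) i k * v k := rfl
    _ ≤ ∑ i, u i * L := Finset.sum_le_sum fun i _ => mul_le_mul_of_nonneg_left (hrow' i) (hu0 i)
    _ = L * ∑ i, u i := by rw [Finset.mul_sum]; exact Finset.sum_congr rfl fun i _ => mul_comm _ _

/-- For 0/1 vectors `u, v` and `B ≥ 0` with `≤ L` unsigned column degrees: `uᵀ(Σ_e B_e)v ≤ L·Σv`. -/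
theorem disc_unsigned_le_col (B : Fin m → Matrix α β ℝ) (hB : ∀ e i k, 0 ≤ B e i k) {L : ℝ}
    (hcol : ∀ k, ∑ e, ∑ i, B e i k ≤ L) (u : α → ℝ) (v : β → ℝ)
    (hu : ∀ i, u i = 0 ∨ u i = 1) (hv : ∀ k, v k = 0 ∨ v k = 1) :
    u ⬝ᵥ ((∑ e, B e) *ᵥ v) ≤ L * ∑ k, v k := by
  have hu1 : ∀ i, u i ≤ 1 := fun i => by rcases hu i with h | h <;> simp [h]
  have hu0 : ∀ i, 0 ≤ u i := fun i => by rcases hu i with h | h <;> simp [h]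
  have hv0 : ∀ k, 0 ≤ v k := fun k => by rcases hv k with h | h <;> simp [h]
  have hBs : ∀ i k, 0 ≤ (∑ e, B e) i k := fun i k => by
    rw [Matrix.sum_apply]; exact Finset.sum_nonneg fun e _ => hB e i k
  have hcol' : ∀ k, ∑ i, (∑ e, B e) i k ≤ L := by
    intro k
    calc ∑ i, (∑ e, B e) i k = ∑ e, ∑ i, B e i k := by simp only [Matrix.sum_apply]; rw [Finset.sum_comm]
      _ ≤ L := hcol k
  calc u ⬝ᵥ ((∑ e, B e) *ᵥ v) = ∑ i, u i * ∑ k, (∑ e, B e) i k * v k := rfl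
    _ ≤ ∑ i, ∑ k, (∑ e, B e) i k * v k := by
        refine Finset.sum_le_sum fun i _ => ?_
        have h0 : 0 ≤ ∑ k, (∑ e, B e) i k * v k :=
          Finset.sum_nonneg fun k _ => mul_nonneg (hBs i k) (hv0 k)
        nlinarith [hu1 i, hu0 i]
    _ = ∑ k, (∑ i, (∑ e, B e) i k) * v k := by
        rw [Finset.sum_comm]; exact Finset.sum_congr rfl fun k _ => by rw [Finset.sum_mul]
    _ ≤ ∑ k, L * v k := Finset.sum_le_sum fun k _ => mul_le_mul_of_nonneg_right (hcol' k) (hv0 k)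
    _ = L * ∑ k, v k := by rw [Finset.mul_sum]

/-- One leg-vector against 0/1 vectors: `0 ≤ uᵀB_e v ≤ Σ_{ik} B_e i k`. -/
theorem disc_leg_le (Be : Matrix α β ℝ) (hB : ∀ i k, 0 ≤ Be i k) (u : α → ℝ) (v : β → ℝ)
    (hu : ∀ i, u i = 0 ∨ u i = 1) (hv : ∀ k, v k = 0 ∨ v k = 1) :
    0 ≤ u ⬝ᵥ (Be *ᵥ v) ∧ u ⬝ᵥ (Be *ᵥ v) ≤ ∑ i, ∑ k, Be i k := by
  have hu0 : ∀ i, 0 ≤ u i := fun i => by rcases hu i with h | h <;> simp [h]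
  have hu1 : ∀ i, u i ≤ 1 := fun i => by rcases hu i with h | h <;> simp [h]
  have hv0 : ∀ k, 0 ≤ v k := fun k => by rcases hv k with h | h <;> simp [h]
  have hv1 : ∀ k, v k ≤ 1 := fun k => by rcases hv k with h | h <;> simp [h]
  have hin : ∀ i, 0 ≤ ∑ k, Be i k * v k ∧ ∑ k, Be i k * v k ≤ ∑ k, Be i k := fun i =>
    ⟨Finset.sum_nonneg fun k _ => mul_nonneg (hB i k) (hv0 k),
     Finset.sum_le_sum fun k _ => by nlinarith [hB i k, hv1 k]⟩
  refine ⟨Finset.sum_nonneg fun i _ => mul_nonneg (hu0 i) (hin i).1, ?_⟩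
  calc u ⬝ᵥ (Be *ᵥ v) = ∑ i, u i * ∑ k, Be i k * v k := rfl
    _ ≤ ∑ i, ∑ k, Be i k := Finset.sum_le_sum fun i _ => by
        nlinarith [hu0 i, hu1 i, (hin i).1, (hin i).2]

/-- PER-SET HOEFFDING STEP: for a fixed vertex set `S`, the signings whose signed discrepancy on
`(S∩α, S∩β)` exceeds `γ'√(|S∩α|·|S∩β|)` number at most `2·2^m·exp(−γ'²|S|/(12L))`. -/
theorem card_badAt_le [DecidableEq α] [DecidableEq β] (B : Fin m → Matrix α β ℝ)
    (hB : ∀ e i k, 0 ≤ B e i k) (hlegs : ∀ e, ∑ i, ∑ k, B e i k ≤ 3) {L : ℝ} (hL : 0 < L)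
    (hrow : ∀ i, ∑ e, ∑ k, B e i k ≤ L) (hcol : ∀ k, ∑ e, ∑ i, B e i k ≤ L)
    {γ' : ℝ} (hγ' : 0 ≤ γ') (S : Finset (α ⊕ β)) :
    ((Finset.univ.filter (fun T : Fin m → Bool =>
        γ' * Real.sqrt ((∑ i, (if Sum.inl i ∈ S then (1 : ℝ) else 0))
              * (∑ k, (if Sum.inr k ∈ S then (1 : ℝ) else 0)))
          < |(fun i => if Sum.inl i ∈ S then (1 : ℝ) else 0) ⬝ᵥ
              (sgnMat B T *ᵥ (fun k => if Sum.inr k ∈ S then (1 : ℝ) else 0))|)).card : ℝ)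
      ≤ 2 * (2 ^ m * Real.exp (-(γ' ^ 2 * S.card / (12 * L)))) := by
  set u : α → ℝ := fun i => if Sum.inl i ∈ S then (1 : ℝ) else 0 with hu_def
  set v : β → ℝ := fun k => if Sum.inr k ∈ S then (1 : ℝ) else 0 with hv_def
  have hu : ∀ i, u i = 0 ∨ u i = 1 := fun i => by
    simp only [hu_def]; split_ifs <;> simp
  have hv : ∀ k, v k = 0 ∨ v k = 1 := fun k => by
    simp only [hv_def]; split_ifs <;> simp
  set a : ℝ := ∑ i, u i with ha_def
  set b : ℝ := ∑ k, v k with hb_def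
  have ha : 0 ≤ a := Finset.sum_nonneg fun i _ => by rcases hu i with h | h <;> simp [h]
  have hb : 0 ≤ b := Finset.sum_nonneg fun k _ => by rcases hv k with h | h <;> simp [h]
  have hab : a + b = S.card := sum_indicator_inl_add_inr S
  -- the Hoeffding coefficients
  set c : Fin m → ℝ := fun e => u ⬝ᵥ (B e *ᵥ v) with hc_def
  have hc0 : ∀ e, 0 ≤ c e := fun e => (disc_leg_le (B e) (hB e) u v hu hv).1
  have hc3 : ∀ e, c e ≤ 3 := fun e => (disc_leg_le (B e) (hB e) u v hu hv).2.trans (hlegs e)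
  have hcsum : ∑ e, c e = u ⬝ᵥ ((∑ e, B e) *ᵥ v) := by
    rw [Matrix.sum_mulVec, dotProduct_sum]
  set K : ℝ := ∑ e, c e ^ 2 with hK_def
  have hK3 : K ≤ 3 * ∑ e, c e := by
    rw [hK_def, Finset.mul_sum]
    exact Finset.sum_le_sum fun e _ => by nlinarith [hc0 e, hc3 e]
  have hKa : K ≤ 3 * (L * a) :=
    hK3.trans (by rw [hcsum]; nlinarith [disc_unsigned_le_row B hB hrow u v hu hv])
  have hKb : K ≤ 3 * (L * b) :=
    hK3.trans (by rw [hcsum]; nlinarith [disc_unsigned_le_col B hB hcol u v hu hv])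
  have hK0 : 0 ≤ K := Finset.sum_nonneg fun e _ => sq_nonneg _
  -- the signed discrepancy is the sign-sum with coefficients `c`
  have hform : ∀ T : Fin m → Bool,
      u ⬝ᵥ (sgnMat B T *ᵥ v) = ∑ e, c e * ((CandCutNorm.boolSign (T e) : ℤ) : ℝ) := by
    intro T
    rw [dotProduct_sgnMat_mulVec]
    exact Finset.sum_congr rfl fun e _ => mul_comm _ _
  have hRHS : 0 ≤ 2 * (2 ^ m * Real.exp (-(γ' ^ 2 * S.card / (12 * L)))) := by positivity
  rcases eq_or_lt_of_le hK0 with hKz | hKpos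
  · -- K = 0: all coefficients vanish, the event is empty
    have hcz : ∀ e, c e = 0 := fun e => by
      have := (Finset.sum_eq_zero_iff_of_nonneg (fun e _ => sq_nonneg (c e))).1 hKz.symm e
        (Finset.mem_univ e)
      exact pow_eq_zero_iff (n := 2) (by norm_num) |>.1 this
    have hempty : (Finset.univ.filter (fun T : Fin m → Bool =>
        γ' * Real.sqrt (a * b) < |u ⬝ᵥ (sgnMat B T *ᵥ v)|)) = ∅ := by
      refine Finset.filter_false_of_mem fun T _ => ?_
      rw [hform T, Finset.sum_eq_zero fun e _ => by rw [hcz e, zero_mul], abs_zero, not_lt]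
      positivity
    rw [hempty, Finset.card_empty, Nat.cast_zero]
    exact hRHS
  · -- K > 0: Hoeffding
    set t : ℝ := γ' * Real.sqrt (a * b) with ht_def
    have ht : 0 ≤ t := mul_nonneg hγ' (Real.sqrt_nonneg _)
    have hsub : Finset.univ.filter (fun T : Fin m → Bool => t < |u ⬝ᵥ (sgnMat B T *ᵥ v)|)
        ⊆ Finset.univ.filter (fun T : Fin m → Bool =>
            t ≤ |∑ e, c e * ((CandCutNorm.boolSign (T e) : ℤ) : ℝ)|) := by
      intro T hT
      simp only [Finset.mem_filter, Finset.mem_univ, true_and] at hT ⊢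
      rw [← hform T]; exact hT.le
    have hH := card_abs_signSum_ge_le m c ht hKpos
    have hexp : Real.exp (-(t ^ 2 / (2 * K))) ≤ Real.exp (-(γ' ^ 2 * S.card / (12 * L))) := by
      rw [Real.exp_le_exp, neg_le_neg_iff, ← hab]
      have ht2 : t ^ 2 = γ' ^ 2 * (a * b) := by
        rw [ht_def, mul_pow, Real.sq_sqrt (mul_nonneg ha hb)]
      rw [ht2, div_le_div_iff₀ (by positivity) (by positivity)]
      have h1 : (a + b) * (2 * K) ≤ 12 * L * (a * b) := by
        nlinarith [mul_le_mul_of_nonneg_right hKb ha, mul_le_mul_of_nonneg_right hKa hb]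
      calc γ' ^ 2 * (a + b) * (2 * K) = γ' ^ 2 * ((a + b) * (2 * K)) := by ring
        _ ≤ γ' ^ 2 * (12 * L * (a * b)) := mul_le_mul_of_nonneg_left h1 (sq_nonneg _)
        _ = γ' ^ 2 * (a * b) * (12 * L) := by ring
    calc ((Finset.univ.filter (fun T : Fin m → Bool => t < |u ⬝ᵥ (sgnMat B T *ᵥ v)|)).card : ℝ)
        ≤ ((Finset.univ.filter (fun T : Fin m → Bool =>
            t ≤ |∑ e, c e * ((CandCutNorm.boolSign (T e) : ℤ) : ℝ)|)).card : ℝ) := by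
          exact_mod_cast Finset.card_le_card hsub
      _ ≤ 2 * (2 ^ m * Real.exp (-(t ^ 2 / (2 * K)))) := hH
      _ ≤ 2 * (2 ^ m * Real.exp (-(γ' ^ 2 * S.card / (12 * L)))) := by gcongr

/-- Connected vertex sets of size `k ≥ 1` in a graph of maximum degree `≤ Ldeg` on `α ⊕ β` number at most
`(|α|+|β|)·Ldeg^{2(k-1)}` (Finset-filter form of `card_connectedSets_le`). -/
theorem card_filter_connected_card_eq_le [DecidableEq α] [DecidableEq β] (G : SimpleGraph (α ⊕ β))
    [DecidableRel G.Adj] {Ldeg : ℕ} (hdeg : ∀ x, G.degree x ≤ Ldeg) (k : ℕ) (hk : 1 ≤ k)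
    (𝒮 : Finset (Finset (α ⊕ β))) (h𝒮 : ∀ S ∈ 𝒮, (G.induce (S : Set (α ⊕ β))).Connected) :
    (((𝒮.filter (fun S => S.card = k)).card : ℕ) : ℝ)
      ≤ (Fintype.card α + Fintype.card β) * (Ldeg : ℝ) ^ (2 * (k - 1)) := by
  classical
  obtain ⟨n, rfl⟩ : ∃ n, k = n + 1 := ⟨k - 1, by omega⟩
  have hsub : 𝒮.filter (fun S => S.card = n + 1)
      ⊆ Finset.univ.filter (fun S : Finset (α ⊕ β) =>
          S.card = n + 1 ∧ (G.induce (S : Set (α ⊕ β))).Connected) := by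
    intro S hS
    simp only [Finset.mem_filter, Finset.mem_univ, true_and] at hS ⊢
    exact ⟨hS.2, h𝒮 S hS.1⟩
  have h1 : (𝒮.filter (fun S => S.card = n + 1)).card
      ≤ Nat.card {S : Finset (α ⊕ β) // S.card = n + 1 ∧ (G.induce (S : Set (α ⊕ β))).Connected} := by
    rw [Nat.card_eq_fintype_card, Fintype.card_subtype]
    exact Finset.card_le_card hsub
  have h2 := card_connectedSets_le G hdeg n
  have h3 : (((𝒮.filter (fun S => S.card = n + 1)).card : ℕ) : ℝ)
      ≤ ((Fintype.card (α ⊕ β) * Ldeg ^ (2 * n) : ℕ) : ℝ) := by exact_mod_cast h1.trans h2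
  simpa [Fintype.card_sum, Nat.add_sub_cancel] using h3

/-- PROP. 7, PROBABILISTIC HALF: the bad signings (some connected `S`, `|S| > t₀`, with signed discrepancy
`> γ'√(|S∩α|·|S∩β|)`) number at most `2^m · 2(|α|+|β|) · Σ_{k ∈ (t₀, |α|+|β|]} Ldeg^{2(k-1)}·e^{−γ'²k/(12L)}`. -/
theorem card_badSignings_le [DecidableEq α] [DecidableEq β] (B : Fin m → Matrix α β ℝ)
    (hB : ∀ e i k, 0 ≤ B e i k) (hlegs : ∀ e, ∑ i, ∑ k, B e i k ≤ 3) {L : ℝ} (hL : 0 < L)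
    (hrow : ∀ i, ∑ e, ∑ k, B e i k ≤ L) (hcol : ∀ k, ∑ e, ∑ i, B e i k ≤ L)
    (G : SimpleGraph (α ⊕ β)) [DecidableRel G.Adj] {Ldeg : ℕ} (hdeg : ∀ x, G.degree x ≤ Ldeg)
    {γ' : ℝ} (hγ' : 0 ≤ γ') (t₀ : ℕ) :
    (Nat.card {T : Fin m → Bool //
        ∃ S : Finset (α ⊕ β), (G.induce (S : Set (α ⊕ β))).Connected ∧ t₀ < S.card ∧
          γ' * Real.sqrt ((∑ i, (if Sum.inl i ∈ S then (1 : ℝ) else 0))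
                * (∑ k, (if Sum.inr k ∈ S then (1 : ℝ) else 0)))
            < |(fun i => if Sum.inl i ∈ S then (1 : ℝ) else 0) ⬝ᵥ
                (sgnMat B T *ᵥ (fun k => if Sum.inr k ∈ S then (1 : ℝ) else 0))|} : ℝ)
      ≤ 2 ^ m * (2 * (Fintype.card α + Fintype.card β)
          * ∑ k ∈ Finset.Ioc t₀ (Fintype.card α + Fintype.card β),
              (Ldeg : ℝ) ^ (2 * (k - 1)) * Real.exp (-(γ' ^ 2 * k / (12 * L)))) := by
  classical
  -- abbreviations
  set N : ℕ := Fintype.card α + Fintype.card β with hN_def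
  let badP : Finset (α ⊕ β) → (Fin m → Bool) → Prop := fun S T =>
    γ' * Real.sqrt ((∑ i, (if Sum.inl i ∈ S then (1 : ℝ) else 0))
          * (∑ k, (if Sum.inr k ∈ S then (1 : ℝ) else 0)))
      < |(fun i => if Sum.inl i ∈ S then (1 : ℝ) else 0) ⬝ᵥ
          (sgnMat B T *ᵥ (fun k => if Sum.inr k ∈ S then (1 : ℝ) else 0))|
  let badAt : Finset (α ⊕ β) → Finset (Fin m → Bool) := fun S => Finset.univ.filter (fun T => badP S T)
  let 𝒮 : Finset (Finset (α ⊕ β)) :=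
    Finset.univ.filter (fun S => (G.induce (S : Set (α ⊕ β))).Connected ∧ t₀ < S.card)
  let g : ℕ → ℝ := fun k => 2 * (2 ^ m * Real.exp (-(γ' ^ 2 * k / (12 * L))))
  -- Nat.card of the bad signings = card of a filter, contained in the union of the `badAt S`
  have hcard : Nat.card {T : Fin m → Bool // ∃ S : Finset (α ⊕ β),
        (G.induce (S : Set (α ⊕ β))).Connected ∧ t₀ < S.card ∧ badP S T}
      = (Finset.univ.filter (fun T : Fin m → Bool => ∃ S : Finset (α ⊕ β),
          (G.induce (S : Set (α ⊕ β))).Connected ∧ t₀ < S.card ∧ badP S T)).card := by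
    rw [Nat.card_eq_fintype_card, Fintype.card_subtype]
  have hsub : Finset.univ.filter (fun T : Fin m → Bool => ∃ S : Finset (α ⊕ β),
        (G.induce (S : Set (α ⊕ β))).Connected ∧ t₀ < S.card ∧ badP S T) ⊆ 𝒮.biUnion badAt := by
    intro T hT
    simp only [Finset.mem_filter, Finset.mem_univ, true_and] at hT
    obtain ⟨S, h1, h2, h3⟩ := hT
    simp only [Finset.mem_biUnion, Finset.mem_filter, Finset.mem_univ, true_and, 𝒮, badAt]
    exact ⟨S, ⟨h1, h2⟩, h3⟩
  have step1 : ((Finset.univ.filter (fun T : Fin m → Bool => ∃ S : Finset (α ⊕ β),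
        (G.induce (S : Set (α ⊕ β))).Connected ∧ t₀ < S.card ∧ badP S T)).card : ℝ)
      ≤ ∑ S ∈ 𝒮, ((badAt S).card : ℝ) := by
    have := (Finset.card_le_card hsub).trans Finset.card_biUnion_le
    exact_mod_cast this
  have step2 : ∑ S ∈ 𝒮, ((badAt S).card : ℝ) ≤ ∑ S ∈ 𝒮, g S.card :=
    Finset.sum_le_sum fun S _ => card_badAt_le B hB hlegs hL hrow hcol hγ' S
  -- regroup by the size of `S`
  have hmaps : ∀ S ∈ 𝒮, S.card ∈ Finset.Ioc t₀ N := by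
    intro S hS
    simp only [Finset.mem_filter, Finset.mem_univ, true_and, 𝒮] at hS
    rw [Finset.mem_Ioc]
    exact ⟨hS.2, by rw [hN_def, ← Fintype.card_sum]; exact Finset.card_le_univ S⟩
  have step3 : ∑ S ∈ 𝒮, g S.card
      = ∑ k ∈ Finset.Ioc t₀ N, ((𝒮.filter (fun S => S.card = k)).card : ℝ) * g k := by
    rw [← Finset.sum_fiberwise_of_maps_to hmaps]
    refine Finset.sum_congr rfl fun k _ => ?_
    rw [Finset.sum_congr rfl fun S hS => by rw [(Finset.mem_filter.1 hS).2], Finset.sum_const,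
      nsmul_eq_mul]
  have h𝒮 : ∀ S ∈ 𝒮, (G.induce (S : Set (α ⊕ β))).Connected := fun S hS => by
    simp only [Finset.mem_filter, Finset.mem_univ, true_and, 𝒮] at hS; exact hS.1
  have hg : ∀ k, 0 ≤ g k := fun k => by positivity
  have step4 : ∑ k ∈ Finset.Ioc t₀ N, ((𝒮.filter (fun S => S.card = k)).card : ℝ) * g k
      ≤ ∑ k ∈ Finset.Ioc t₀ N, ((N : ℝ) * (Ldeg : ℝ) ^ (2 * (k - 1))) * g k := by
    refine Finset.sum_le_sum fun k hk => mul_le_mul_of_nonneg_right ?_ (hg k)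
    have hk1 : 1 ≤ k := by rw [Finset.mem_Ioc] at hk; omega
    have := card_filter_connected_card_eq_le G hdeg k hk1 𝒮 h𝒮
    simpa [hN_def] using this
  have step5 : ∑ k ∈ Finset.Ioc t₀ N, ((N : ℝ) * (Ldeg : ℝ) ^ (2 * (k - 1))) * g k
      = 2 ^ m * (2 * (N : ℝ) * ∑ k ∈ Finset.Ioc t₀ N,
          (Ldeg : ℝ) ^ (2 * (k - 1)) * Real.exp (-(γ' ^ 2 * k / (12 * L)))) := by
    rw [Finset.mul_sum, Finset.mul_sum]
    exact Finset.sum_congr rfl fun k _ => by ring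
  rw [hcard]
  calc ((Finset.univ.filter (fun T : Fin m → Bool => ∃ S : Finset (α ⊕ β),
        (G.induce (S : Set (α ⊕ β))).Connected ∧ t₀ < S.card ∧ badP S T)).card : ℝ)
      ≤ ∑ S ∈ 𝒮, ((badAt S).card : ℝ) := step1
    _ ≤ ∑ S ∈ 𝒮, g S.card := step2
    _ = ∑ k ∈ Finset.Ioc t₀ N, ((𝒮.filter (fun S => S.card = k)).card : ℝ) * g k := step3
    _ ≤ ∑ k ∈ Finset.Ioc t₀ N, ((N : ℝ) * (Ldeg : ℝ) ^ (2 * (k - 1))) * g k := step4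
    _ = 2 ^ m * (2 * (N : ℝ) * ∑ k ∈ Finset.Ioc t₀ N,
          (Ldeg : ℝ) ^ (2 * (k - 1)) * Real.exp (-(γ' ^ 2 * k / (12 * L)))) := step5
    _ = _ := by simp [hN_def]

end Summit.PneNP.PneNP.Theorems.SfmBl
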